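import Mathlib
import Summits.Ventures.HodgeRepro.Tier4.Line1.RTFSetting
import Summits.Ventures.HodgeRepro.Tier4.Line1.KernelSupportFinite
import Summits.Ventures.HodgeRepro.Tier4.Line1.KernelUnfold
import Summits.Ventures.HodgeRepro.Tier4.Line1.KernelOperator

/-!
# Tier4/Line1/KernelTranslate — LINE L1, the translation action on `L²(G)` and its continuity (for J1 rung (4a))

Blind re-derivation cell `pub-hodge-repro`, Tier 4 «prove the step» (README §9–§10), seat t4-L1-p1 (prover, gen 0),
LINE L1 (the RTF line): the analytic input of J1 rung (4a) `kernelOp_nondegenerate` (the lead's cut S12414, module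
`Tier4/Line1/KernelNondegenerate.lean`), split off for size.  For a rational `γ ∈ G(k)` and `g ∈ G`, the translation
`x ↦ γ⁻¹ x g` preserves the Haar measure (left invariance and `rightInv`) and acts on `L²(G, μ)` classes
(`translLp`); the map `g ↦ ⟨χ, φ(γ⁻¹ · g)⟩_{L²(G)}` is CONTINUOUS — Mathlib's continuity of
`Lp.compMeasurePreserving` in the measure-preserving map (`MeasureTheory.Lp.compMeasurePreserving_continuous`), which
needs the Haar measure regular and locally finite, hence the hypotheses `[LocallyCompactSpace G]`
`[SecondCountableTopology G]` (`Measure.regular_of_isMulLeftInvariant`); the adelic instance has both.  Also: the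
translate by `(1, 1)` is the class itself; for `ψ₀ := 1_D ψ` with `D ⊆ DG` measurable, the translates by `γ ≠ 1` are
orthogonal to `ψ₀` at `g = 1` (`DG ∩ γ DG` is null, `IsFundamentalDomain.aedisjoint`); and the inner product with a
translate is the set integral `∫_{D} ψ₀(γ⁻¹ x g) conj ψ(x) dμ(x)` against the restricted measure.  No `sorry`;
axioms = the trio.

Nothing here says anything about the status of the Hodge conjecture for CM abelian varieties, which is NOT proved
(HC_CM is NOT proved by anyone in this repository).
-/

set_option autoImplicit false

noncomputable section

namespace Summit.Ventures.HodgeRepro.Tier4.Line1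

open MeasureTheory Topology
open scoped Pointwise

namespace RTF

variable {G : Type} [Group G] [TopologicalSpace G] [IsTopologicalGroup G] [MeasurableSpace G]
  [BorelSpace G]

namespace Setting

variable (S : Setting G)

omit [BorelSpace G] in
/-- the translation `x ↦ γ⁻¹ x g` by a rational `γ` on the left and any `g` on the right, as a continuous map. -/
def transl (γ : S.Gk) (g : G) : C(G, G) :=
  ⟨fun x => (γ : G)⁻¹ * x * g, ((continuous_const.mul continuous_id).mul continuous_const)⟩

omit [BorelSpace G] in
/-- the translation, applied. -/
theorem transl_apply (γ : S.Gk) (g x : G) : S.transl γ g x = (γ : G)⁻¹ * x * g := rfl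

omit [BorelSpace G] in
/-- `g ↦ (x ↦ γ⁻¹ x g)` is continuous into `C(G, G)` (compact-open topology). -/
theorem continuous_transl (γ : S.Gk) : Continuous fun g => S.transl γ g :=
  ContinuousMap.continuous_of_continuous_uncurry _
    ((continuous_const.mul (continuous_snd)).mul continuous_fst)

/-- the translations preserve the Haar measure (left invariance + `rightInv`). -/
theorem transl_measurePreserving (γ : S.Gk) (g : G) : MeasurePreserving (S.transl γ g) S.μ S.μ := by
  haveI : S.μ.IsHaarMeasure := S.haar
  haveI : S.μ.IsMulRightInvariant := S.rightInv
  exact (measurePreserving_mul_right S.μ g).comp (measurePreserving_mul_left S.μ (γ : G)⁻¹)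

/-- the translations are measurable embeddings (measurable equivalences). -/
theorem transl_measurableEmbedding (γ : S.Gk) (g : G) : MeasurableEmbedding (S.transl γ g) :=
  (MeasurableEquiv.mulRight g).measurableEmbedding.comp
    (MeasurableEquiv.mulLeft (γ : G)⁻¹).measurableEmbedding

/-- the translate `x ↦ φ(γ⁻¹ x g)` of an `L²(G, μ)` class. -/
def translLp (φ : Lp ℂ 2 S.μ) (γ : S.Gk) (g : G) : Lp ℂ 2 S.μ :=
  Lp.compMeasurePreserving (S.transl γ g) (S.transl_measurePreserving γ g) φ

/-- the translate of a class is, almost everywhere, the translate of a representative. -/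
theorem coeFn_translLp (φ : Lp ℂ 2 S.μ) (γ : S.Gk) (g : G) :
    ⇑(S.translLp φ γ g) =ᵐ[S.μ] fun x => φ ((γ : G)⁻¹ * x * g) :=
  Lp.coeFn_compMeasurePreserving φ (S.transl_measurePreserving γ g)

/-- helper: the Haar measure of a locally compact second countable group is regular. -/
theorem regular_haar [LocallyCompactSpace G] [SecondCountableTopology G] : S.μ.Regular := by
  haveI : S.μ.IsHaarMeasure := S.haar
  obtain ⟨K, hKc, hKn⟩ := exists_compact_mem_nhds (1 : G)
  exact Measure.regular_of_isMulLeftInvariant hKc ⟨1, mem_interior_iff_mem_nhds.mpr hKn⟩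
    hKc.measure_lt_top.ne

/-- the key analytic input: `g ↦ ⟨χ, φ(γ⁻¹ · g)⟩_{L²(G)}` is continuous (Mathlib's continuity of
`Lp.compMeasurePreserving` in the measure-preserving map; the Haar measure is regular and locally finite). -/
theorem continuous_inner_translLp [LocallyCompactSpace G] [SecondCountableTopology G]
    (φ χ : Lp ℂ 2 S.μ) (γ : S.Gk) : Continuous fun g => Inner.inner ℂ χ (S.translLp φ γ g) := by
  haveI : S.μ.IsHaarMeasure := S.haar
  haveI : S.μ.Regular := S.regular_haar
  refine continuous_const.inner ?_
  rw [continuous_iff_continuousAt]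
  intro g₀
  exact Filter.Tendsto.compMeasurePreservingLp (f := fun _ => φ) tendsto_const_nhds
    ((S.continuous_transl γ).tendsto g₀) (fun g => S.transl_measurePreserving γ g)
    (S.transl_measurePreserving γ g₀) (by norm_num)

/-- the translate by `(1, 1)` is the class itself. -/
theorem translLp_one_one (φ : Lp ℂ 2 S.μ) : S.translLp φ 1 1 = φ := by
  apply Lp.ext
  filter_upwards [S.coeFn_translLp φ 1 1] with x hx
  rw [hx]
  simp

/-- at `g = 1`, the translates by `γ ≠ 1` of a class supported in a measurable `D ⊆ DG` are orthogonal to it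
(`DG ∩ γ DG` is null: `IsFundamentalDomain.aedisjoint`). -/
theorem inner_translLp_one_eq_zero {D : Set G} (hD : D ⊆ S.DG) {ψ : G → ℂ}
    (hψ : MemLp (D.indicator ψ) 2 S.μ) {γ : S.Gk} (hγ : γ ≠ 1) :
    Inner.inner ℂ (hψ.toLp _) (S.translLp (hψ.toLp _) γ 1) = 0 := by
  rw [L2.inner_def]
  refine integral_eq_zero_of_ae ?_
  have h1 : ⇑(hψ.toLp _) =ᵐ[S.μ] D.indicator ψ := MemLp.coeFn_toLp hψ
  have h2 : ⇑(S.translLp (hψ.toLp _) γ 1) =ᵐ[S.μ]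
      fun x => D.indicator ψ ((γ : G)⁻¹ * x * 1) := by
    filter_upwards [S.coeFn_translLp (hψ.toLp _) γ 1,
      (S.transl_measurePreserving γ 1).quasiMeasurePreserving.ae_eq_comp h1] with x hx hx'
    rw [hx]
    exact hx'
  have hdisj : ∀ᵐ x ∂S.μ, x ∉ (γ • S.DG) ∩ ((1 : S.Gk) • S.DG) := by
    rw [← measure_eq_zero_iff_ae_notMem]
    exact S.fdG.aedisjoint hγ
  filter_upwards [h1, h2, hdisj] with x hx1 hx2 hx3
  rw [Pi.zero_apply, RCLike.inner_apply, hx1, hx2]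
  by_cases hxD : x ∈ D
  · by_cases hyD : (γ : G)⁻¹ * x * 1 ∈ D
    · exfalso
      apply hx3
      refine ⟨⟨(γ : G)⁻¹ * x * 1, hD hyD, ?_⟩, ⟨x, hD hxD, ?_⟩⟩
      · show (γ : G) * ((γ : G)⁻¹ * x * 1) = x
        group
      · show ((1 : S.Gk) : G) * x = x
        simp
    · rw [Set.indicator_of_notMem hyD, zero_mul]
  · rw [Set.indicator_of_notMem hxD, map_zero, mul_zero]

/-- the inner product with a translate, as a set integral over `D` against the restricted measure. -/
theorem inner_translLp_eq_integral {D : Set G} (hDm : MeasurableSet D)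
    (hres : S.μ.restrict D = S.μ.restrict S.DG) (ψ : G → ℂ) (hψ : MemLp (D.indicator ψ) 2 S.μ)
    (γ : S.Gk) (g : G) :
    Inner.inner ℂ (hψ.toLp _) (S.translLp (hψ.toLp _) γ g) =
      ∫ x, D.indicator ψ ((γ : G)⁻¹ * x * g) * starRingEnd ℂ (ψ x) ∂(S.μ.restrict S.DG) := by
  rw [L2.inner_def]
  have h1 : ⇑(hψ.toLp _) =ᵐ[S.μ] D.indicator ψ := MemLp.coeFn_toLp hψ
  have h2 : ⇑(S.translLp (hψ.toLp _) γ g) =ᵐ[S.μ]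
      fun x => D.indicator ψ ((γ : G)⁻¹ * x * g) := by
    filter_upwards [S.coeFn_translLp (hψ.toLp _) γ g,
      (S.transl_measurePreserving γ g).quasiMeasurePreserving.ae_eq_comp h1] with x hx hx'
    rw [hx]
    exact hx'
  have h3 : (fun x => Inner.inner ℂ ((hψ.toLp _ : Lp ℂ 2 S.μ) x) ((S.translLp (hψ.toLp _) γ g) x))
      =ᵐ[S.μ] D.indicator (fun x => D.indicator ψ ((γ : G)⁻¹ * x * g) * starRingEnd ℂ (ψ x)) := by
    filter_upwards [h1, h2] with x hx1 hx2
    rw [RCLike.inner_apply, hx1, hx2]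
    by_cases hxD : x ∈ D
    · simp [Set.indicator_of_mem hxD]
    · simp [Set.indicator_of_notMem hxD]
  rw [integral_congr_ae h3, integral_indicator hDm, hres]

end Setting

end RTF

end Summit.Ventures.HodgeRepro.Tier4.Line1

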